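import Summits.QuantumFields.YangMills.Theorems.FluctuationComparisonRegPrIntLS1aAlphaPhiMTowerBG
import Summits.QuantumFields.YangMills.Theorems.FluctuationComparisonRegPrIntLS1aHistoryLettersAtomic
import HarnessLib

/-!
# S1a · THE ᴬ-EDITION OF THE (m)-DOOR OF RECORD FOR THE LINE's TOWER (✓p831345 → print's ATOMIC large-field letters): the (α)-package + the five letters at `(K, K−j)`
# + the supplier's (E)-domains ∕ plateau targets ∕ support windows ∕ per-plaquette large events + ONE ATOMIC LETTER PER (history `S ⊆ [j,Ts)`, choice `π` of one large
# plaquette per height of `S`) ⟹ the letter `Φ_m` OF THE CUT DENSITY at every height of every invariantly and measurably cut tower — the binder `hdomBG_j` of ✓p831345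
# DISCHARGED BY NAME through the second (print-shaped) road ✓p835208 ∘ ✓p835438 ∘ ✓p835663

Cell `ym3-torus` (YM ladder rung R3 = continuum `SU(2)` Yang–Mills on the three-torus — a RUNG: NOT d = 4, NOT infinite volume, NOT a mass gap, NOT Clay).
Width seat «width 8» `ym3-torus-px8` (gen 27), FREE px helper on crux `stmt-QuantumFields-20520`, count-neutral, DEFINITION-FREE, default heartbeats.  FILE 4 of the seat.

WHY.  ✓p831345 `…S1aAlphaPhiMTowerBG.exists_admissible_schedule_phiM_tower_bg` is the (m)-door of record of the (m)_E node (UV3-NODE §69.18): (α)-package + five letters +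
the cut-height letter `hdomBG_j` ⟹ `Φ_m` of the cut density, one admissible schedule, every height; g26's ✓p833619 is its ᵀ-edition (`hdomBG_j` replaced by one TRANSPORT letter
per height — the first, probabilist's road).  This seat's ✓p835208 ∘ ✓p835438 ∘ ✓p835663 reduce `hdomBG_j` BY KERNEL along print's own road ([Balaban1985UV3] (7)→(41): the
decomposition of unity into large-field histories read RELATIVE to its all-small-field term) down to ATOMIC letters — one small factor `ε_i` per large plaquette, per history
`S ⊆ [j, Ts)` and choice `π` of one large plaquette per height of `S`, on Bałaban's restricted renormalised densities `ρ^{E}_{K−j}` — with the exponent budget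
`Δ_j := Σ_{i∈[j,Ts)} |Plaq^{(i+1)}|·ε_i ≤ (c∕(1−q))·q^j` from `|Plaq^{(i+1)}|·ε_i ≤ c·q^i` (✓`sum_Ico_le_geom`) kept admissible by ✓`admissible_add_slack`.  THIS FILE is the composed
door: the SAME statement as ✓p833619 with (i) the per-step sizes `(η, hη)` replaced by `(ε, hε : 0 ≤ ε, hεc : |Plaq^{(i+1)}|·ε_i ≤ c·q^i)`; (ii) the binder block «`Dm Tg`,
`MeasurableSet (Tg i)`, `Tg i ⊆ Dm i`, `IsOpen (Dm j)`, plateau, (E)-good ⊆ `Dm j`, TRANSPORT LETTERS» replaced by «`Dm Tg Sp`, `Lg`, `MeasurableSet (Tg i)`, `MeasurableSet (Sp i)`,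
`MeasurableSet (Lg i p)`, `IsOpen (Dm j)`, plateau `χ_i = 1` on `Tg i`, support `χ_i ≤ 0` off `Sp i`, cover `(Tg i)ᶜ ⊆ ⋃_p Lg i p`, (E)-good ⊆ `Dm j`, ATOMIC LETTERS»
(`Tg i ⊆ Dm i` is NOT needed on this road).  Everything else — the (α)-arguments, `∃ prm, AdmissibleClassParams … ∧ fields`, the run∕tower scope, the four class binders + LF
clause and the WHOLE `Φ_m` conclusion with `{prm j with β := β_K}` — is ✓p833619's (= ✓p831345's) text byte for byte (DIFF in HOME `ym3-torus-px8/g27/`).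

WHAT.  ★★★ `exists_admissible_schedule_phiM_tower_atomic` (0 `def`, 0 `sorry`; proof = ✓p831345 at `Δ_j := (c∕(1−q))·q^j` ∘ ✓`hdomBG_of_atomicLetters` ∘ ✓`sum_Ico_le_geom`).
★p1's DISPLAYED BINDER LIST of the (m)_E door after this file: {(α)-inhabitant `AlphaInputsT3ACFullTriv` (UNINHABITED) · `hlowc`∕`hupc`∕`hRegClass`∕`hlfle`∕`hlarge` at `(K, K−j)` ·
the (E)-data `Dm∕Tg∕Sp∕Lg` with their side conditions (for the line's `sfCut θ_i`: `Tg_i = {∀p, dist1 ≤ θ_i∕2}`, `Sp_i = {∀p, dist1 < 24θ_i∕25}`, `Lg i p = {θ_i∕2 < dist1(U(∂p))}` —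
✓p835438 §4's ramp one-liners) + «(E)-good ⊆ Dm j» · ONE ATOMIC LETTER per `(S, π)` in PRINT's currency · the (R-β1′) β slot `{prm j with β := β_K}`} — and nothing else.

HONEST: a composition of landed doors; the atomic letters are HYPOTHESES (print's «small factor `e^{−¼p²(g_j)}` for all plaquettes in all large fields set P» (71) p.273 read
RELATIVE to the all-small term — inputs named in UV3-NODE §69.20 (4): (71) itself, variational monotonicity (42), the relative history cost = locality of the effective-action
difference (NOT a printed sentence), resummation∕entropy (kernel)); nothing of Bałaban's renormalisation-group analysis asserted or proved; (m) AS TYPED suspect-false at `L = 3`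
(RULING №105), (m)_E OPEN; the five registered stubs (3732b7df) ∕ 20520 ∕ 19936 ∕ 19200 ∕ `YM3TorusSU2` NOT proved; rung R3 = SU(2) YM₃ on T³ — NOT d = 4, NOT infinite volume, NOT
a mass gap, NOT Clay.  Sorry-free, axioms standard.
References: [Balaban1985UV3] CMP 102 (1985) (2) p.256, (7) p.257, (41) p.266, (47) p.267, (71) p.273; [Balaban1987RG1] CMP 109 (1987) (0.11)∕(0.13) pp.253–254.
-/

set_option autoImplicit false

noncomputable section

namespace Summit.QuantumFields.YangMills.Theorems.FluctuationComparisonRegPrIntLS1aAlphaPhiMTowerAtomic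

open MeasureTheory Set
open Literature.MathematicalPhysics.QuantumFieldTheory.Balaban1983to89
open T3ContinuumYM3Torus T3UnitScaleTilt T3UnitLawDensityEML T3RestrictedUnitDensity T3AlphaInputsAC T3AlphaInputsACSchemas T3AlphaInputsACTrivRows BalabanUVClass
open T3NestedUnitLaws (descend)
open T3LevelShift (fieldShift)
open T3TiltDescent (heightDensity descendTo)
open B5Eq118OneStroke (iterBlockOf)
open Literature.MathematicalPhysics.QuantumFieldTheory.Balaban1983to89.Missing (partitionFn)
open Summit.QuantumFields.YangMills.Theorems.FluctuationComparisonRegPrIntLS1aAlphaPhiMTowerBG (exists_admissible_schedule_phiM_tower_bg)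
open Summit.QuantumFields.YangMills.Theorems.FluctuationComparisonRegPrIntLS1aDomBGOfOneStepLetters (sum_Ico_le_geom)
open Summit.QuantumFields.YangMills.Theorems.FluctuationComparisonRegPrIntLS1aHistoryLettersAtomic (hdomBG_of_atomicLetters)
open scoped Literature.MathematicalPhysics.QuantumFieldTheory.Balaban1983to89.T3OrbitAverage

variable {F : T3Family} {γ : ℝ}

/-- ★★★ **THE ᴬ-EDITION OF THE (m)-DOOR OF RECORD FOR THE TOWER.**  ✓p831345's statement with the cut-height letter `hdomBG_j` replaced by the supplier's (E)-domains `Dm`,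
plateau targets `Tg` (`χ = 1` there), support windows `Sp` (`χ ≤ 0` outside), per-plaquette large events `Lg` covering `(Tg i)ᶜ`, the inclusion «(E)-good data ⊆ Dm j», and ONE
ATOMIC LETTER per nonempty history `S ⊆ [j, Ts)` and per choice `π` of one plaquette per height of `S`: «`ρ^{E_{S,π}}_{K−j}(V) ≤ (Π_{i∈S} ε_i)·ρ^{E₁}_{K−j}(V)` for `dU_j`-a.e.
`V ∈ Dm j`» on Bałaban's restricted renormalised densities of run `K` (lit `heightDensity`), with per-height sizes `|Plaq^{(i+1)}|·ε_i ≤ c·q^i`; ONE admissible schedule (slack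
enlarged by `(c∕(1−q))·q^j`); conclusion = the v1.2 letter `Φ_m` for the CUT density with the schedule entry `{prm j with β := β_K}`, byte for byte.  Nothing of Bałaban's
asserted; the atomic letters are HYPOTHESES ([Balaban1985UV3] (41) read relative to its all-small term, one small factor (71) per large plaquette).
[cite: Balaban1985UV3, (41)-(47) pp.266-267, (2) p.256, (7) p.257, (71) p.273; Balaban1987RG1, (0.11) p.253] -/
theorem exists_admissible_schedule_phiM_tower_atomic {D : AlphaDataT3 F γ} (W : LFData D) {b₀ p₀ ε₀ C68 Cχ B₃ r CD R₀ C₅ : ℝ} {M₁ : ℕ}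
    (h : AlphaInputsT3ACFullTriv D W b₀ p₀ ε₀ C68 Cχ B₃ M₁ r CD) (hγ : 0 < γ) (hγ1 : γ ≤ 1) (hγe : Real.sqrt γ ≤ Real.exp (1 - p₀)) (hb : 0 ≤ b₀) (hp : 0 ≤ p₀)
    (hr : 0 ≤ r) (hM1 : 1 ≤ M₁) (hMdvd : M₁ ∣ 2 * F.L ^ F.m) (hCD : 0 ≤ CD) (hR₀ : 0 < R₀)
    (ε : ℕ → ℝ) (hε : ∀ i, 0 ≤ ε i) {c q : ℝ} (hq0 : 0 ≤ q) (hq1 : q < 1) (hc : 0 ≤ c)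
    (hεc : ∀ i, (Fintype.card (Plaq (F.P (i + 1)) 0) : ℝ) * ε i ≤ c * q ^ i) :
    ∃ prm : ℕ → ClassParams, AdmissibleClassParams F γ (b₀ / 2) p₀ prm ∧
      (∀ n, (prm n).δ = θBal F.L γ b₀ p₀ n ∧ (prm n).δreg = R₀ ∧ (prm n).δL = θBal F.L γ b₀ p₀ n ∧ (prm n).β = (F.L : ℝ) ^ n / γ ∧
        (prm n).cLF = B10.pFun (b₀ / 2) p₀ (Real.sqrt (γ * ((F.L : ℝ)⁻¹) ^ n)) ^ 2 / 4 ∧ (prm n).c5 = C₅ ∧ (prm n).cE = 0) ∧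
      ∀ (ν : ℕ → (j : ℕ) → Measure (GaugeField (F.P j) 0 (Matrix.specialUnitaryGroup (Fin 2) ℂ))),
        (∀ K, ν K K = T4GenFunBounds.gibbsMeasure (F.P K) ((F.scheme ℰp γ).β K)) →
        (∀ K j, j < K → ν K j = Measure.map (descend F ℰp j) (ν K (j + 1))) →
        ∀ (K Ts : ℕ) (hTs : Ts ≤ K) (μ : (j : ℕ) → Measure (GaugeField (F.P j) 0 (Matrix.specialUnitaryGroup (Fin 2) ℂ)))
          (χ : (j : ℕ) → GaugeField (F.P j) 0 (Matrix.specialUnitaryGroup (Fin 2) ℂ) → ℝ), (∀ j U, χ j U ≤ 1) →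
          (∀ (j : ℕ) (u : GaugeTransf (F.P j) 0 (Matrix.specialUnitaryGroup (Fin 2) ℂ)) (U : GaugeField (F.P j) 0 (Matrix.specialUnitaryGroup (Fin 2) ℂ)),
            χ j (GaugeField.gaugeAct u U) = χ j U) →
          (∀ j, Measurable (χ j)) →
          (∀ j, Ts ≤ j → μ j = ν K j) →
          (∀ j, j < Ts → μ j = Measure.map (descend F ℰp j) ((μ (j + 1)).withDensity fun U => ENNReal.ofReal (χ (j + 1) U))) →
        ∀ (j : ℕ) (hjK : j ≤ K) (ρc ρt : GaugeField (F.P j) 0 (Matrix.specialUnitaryGroup (Fin 2) ℂ) → ℝ),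
          Continuous ρc → Continuous ρt → (∀ V, 0 ≤ ρc V) → (∀ V, 0 ≤ ρt V) →
          μ j = (fieldMeasure (F.P j) 0 (Matrix.specialUnitaryGroup (Fin 2) ℂ)).withDensity (fun V => ENNReal.ofReal (ρc V)) →
          ν K j = (fieldMeasure (F.P j) 0 (Matrix.specialUnitaryGroup (Fin 2) ℂ)).withDensity (fun V => ENNReal.ofReal (ρt V)) →
          ContinuousOn (D.low K (K - j)) {V | PlaqSmall (θBal F.L γ b₀ p₀ j) V} →
          ContinuousOn (D.up K (K - j)) {V | PlaqSmall (θBal F.L γ b₀ p₀ j) V} →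
          (∀ V : GaugeField (F.P K) (K - j) (Matrix.specialUnitaryGroup (Fin 2) ℂ), PlaqSmall (θBal F.L γ b₀ p₀ j) V →
            IsBackground (fun i => BlockAveraging.blockAvg (P := F.P K) (j := i) ℰp) {U | PlaqSmall R₀ U} (K - j) V (D.Umin K (K - j) (D.triv K (K - j)) V)) →
          (∀ V : GaugeField (F.P K) (K - j) (Matrix.specialUnitaryGroup (Fin 2) ℂ),
            Real.exp (D.Ecst K (K - j)) * (Real.exp (-(D.Ecst K (K - j)) + D.Rm K (K - j)) * (D.up K (K - j) V - D.low K (K - j) V)) ≤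
              Real.exp (-(prm j).cLF) * Real.exp (C₅ * Fintype.card (Site (F.P K) (K - j)))) →
          (∀ (V : GaugeField (F.P K) (K - j) (Matrix.specialUnitaryGroup (Fin 2) ℂ)) (S : Finset (Plaq (F.P K) (K - j))),
            (∀ p ∈ S, θBal F.L γ b₀ p₀ j ≤ GaugeGroup.dist1 (GaugeField.plaqHol V p)) →
              Real.exp (D.Ecst K (K - j)) * (partitionFn (G := (Matrix.specialUnitaryGroup (Fin 2) ℂ)) (F.P K) ((F.scheme ℰp γ).β K) * readAtLevel F hjK ρt V) ≤
                Real.exp (-((prm j).cLF * S.card)) * Real.exp (C₅ * Fintype.card (Site (F.P K) (K - j)))) →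
          -- the supplier's (E)-DOMAINS, plateau TARGETS, support WINDOWS and per-plaquette LARGE events per height, and the ATOMIC LETTERS for the histories in `[j, Ts)` (replacing `hdomBG_j`)
          ∀ (Dm Tg Sp : (i : ℕ) → Set (GaugeField (F.P i) 0 (Matrix.specialUnitaryGroup (Fin 2) ℂ)))
            (Lg : (i : ℕ) → Plaq (F.P i) 0 → Set (GaugeField (F.P i) 0 (Matrix.specialUnitaryGroup (Fin 2) ℂ))),
          (∀ i, MeasurableSet (Tg i)) → (∀ i, MeasurableSet (Sp i)) → (∀ i p, MeasurableSet (Lg i p)) → IsOpen (Dm j) →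
          (∀ (i : ℕ), j < i → i ≤ Ts → ∀ U ∈ Tg i, χ i U = 1) →
          (∀ (i : ℕ), j < i → i ≤ Ts → ∀ U, U ∉ Sp i → χ i U ≤ 0) →
          (∀ i U, U ∉ Tg i → ∃ p, U ∈ Lg i p) →
          (∀ V : GaugeField (F.P K) (K - j) (Matrix.specialUnitaryGroup (Fin 2) ℂ), PlaqSmall (θBal F.L γ b₀ p₀ j) V →
            (∃ U₀ : GaugeField (F.P K) 0 (Matrix.specialUnitaryGroup (Fin 2) ℂ),
                IsBackground (fun i => BlockAveraging.blockAvg (P := F.P K) (j := i) ℰp) {U | PlaqSmall R₀ U} (K - j) V U₀ ∧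
                PlaqSmall (θBal F.L γ b₀ p₀ j * ((F.L : ℝ)⁻¹) ^ (2 * (K - j))) U₀) →
            fieldShift (heightShift_eq F hjK) V ∈ Dm j) →
          (∀ S ∈ (Finset.Ico j Ts).powerset, S.Nonempty → ∀ π : (i : ↥S) → Plaq (F.P ((i : ℕ) + 1)) 0,
            ∀ᵐ V ∂(fieldMeasure (F.P j) 0 (Matrix.specialUnitaryGroup (Fin 2) ℂ)), V ∈ Dm j →
              heightDensity F γ hjK {U : GaugeField (F.P K) 0 (Matrix.specialUnitaryGroup (Fin 2) ℂ) |
                  (∀ i : ↥S, ∀ (h : (i : ℕ) + 1 ≤ K), descendTo F ℰp ((i : ℕ) + 1) K h U ∈ Lg ((i : ℕ) + 1) (π i)) ∧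
                  (∀ i ∈ Finset.Ico j Ts, i ∉ S → ∀ (h : i + 1 ≤ K), descendTo F ℰp (i + 1) K h U ∈ Sp (i + 1))} V ≤
                (∏ i ∈ S, ε i) * heightDensity F γ hjK {U : GaugeField (F.P K) 0 (Matrix.specialUnitaryGroup (Fin 2) ℂ) |
                  ∀ i ∈ Finset.Ico j Ts, ∀ (h : i + 1 ≤ K), descendTo F ℰp (i + 1) K h U ∈ Tg (i + 1)} V) →
          ∃ κ : ℝ, ∃ (bg : GaugeField (F.P K) (K - j) (Matrix.specialUnitaryGroup (Fin 2) ℂ) → GaugeField (F.P K) 0 (Matrix.specialUnitaryGroup (Fin 2) ℂ))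
            (nDom : ℕ) (supp : Fin nDom → Set (PBond (F.P K) 0)) (foot : Fin nDom → Finset (Site (F.P K) (K - j)))
            (len : Fin nDom → ℝ) (wt : Fin nDom → ℝ) (act : Fin nDom → GaugeField (F.P K) 0 (Matrix.specialUnitaryGroup (Fin 2) ℂ) → ℝ)
            (cst : ℝ) (lf : GaugeField (F.P K) (K - j) (Matrix.specialUnitaryGroup (Fin 2) ℂ) → ℝ),
            (∀ V, 0 ≤ readAtLevel F hjK (fun U => Real.exp κ * ρc U) V) ∧
            Measurable (readAtLevel F hjK (fun U => Real.exp κ * ρc U)) ∧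
            GaugeField.GaugeInvariant (readAtLevel F hjK (fun U => Real.exp κ * ρc U)) ∧
            (∀ V, PlaqSmall ({ prm j with β := (F.scheme ℰp γ).β K }).δ V →
              IsBackground (fun i => BlockAveraging.blockAvg (P := F.P K) (j := i) ℰp) {U | PlaqSmall ({ prm j with β := (F.scheme ℰp γ).β K }).δreg U} (K - j) V (bg V)) ∧
            (∀ X, (foot X).Nonempty) ∧ (∀ X b, b ∈ supp X → iterBlockOf (K - j) b.src ∈ foot X) ∧ (∀ X, 0 ≤ len X) ∧ (∀ X, 0 ≤ wt X) ∧
            (∀ X, ∀ y ∈ foot X, ∀ y' ∈ foot X, (Site.tdist y y' : ℝ) ≤ ({ prm j with β := (F.scheme ℰp γ).β K }).M * (len X + 1)) ∧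
            (∀ X (U U' : GaugeField (F.P K) 0 (Matrix.specialUnitaryGroup (Fin 2) ℂ)), (∀ b ∈ supp X, U b = U' b) → act X U = act X U') ∧
            (∀ X, GaugeField.GaugeInvariant (act X)) ∧
            (∀ X V, PlaqSmall ({ prm j with β := (F.scheme ℰp γ).β K }).δ V → PlaqSmall (({ prm j with β := (F.scheme ℰp γ).β K }).δ * ((F.L : ℝ)⁻¹) ^ (2 * (K - j))) (bg V) →
              |act X (bg V)| ≤ wt X * Real.exp (-(({ prm j with β := (F.scheme ℰp γ).β K }).κ * len X))) ∧
            (∀ y : Site (F.P K) (K - j), ∑ X ∈ Finset.univ.filter (fun X => y ∈ foot X), wt X * Real.exp (-(({ prm j with β := (F.scheme ℰp γ).β K }).κ * len X)) ≤ ({ prm j with β := (F.scheme ℰp γ).β K }).Ccov) ∧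
            |cst| ≤ ({ prm j with β := (F.scheme ℰp γ).β K }).cE * Fintype.card (Site (F.P K) (K - j)) ∧
            (∀ V, PlaqSmall ({ prm j with β := (F.scheme ℰp γ).β K }).δ V → PlaqSmall (({ prm j with β := (F.scheme ℰp γ).β K }).δ * ((F.L : ℝ)⁻¹) ^ (2 * (K - j))) (bg V) →
              Real.exp (-(({ prm j with β := (F.scheme ℰp γ).β K }).β * wilsonAction4 (bg V)) + (∑ X, act X (bg V)) + cst - ({ prm j with β := (F.scheme ℰp γ).β K }).slack) ≤ readAtLevel F hjK (fun U => Real.exp κ * ρc U) V) ∧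
            (∀ V, PlaqSmall ({ prm j with β := (F.scheme ℰp γ).β K }).δ V → PlaqSmall (({ prm j with β := (F.scheme ℰp γ).β K }).δ * ((F.L : ℝ)⁻¹) ^ (2 * (K - j))) (bg V) →
              readAtLevel F hjK (fun U => Real.exp κ * ρc U) V ≤ Real.exp (-(({ prm j with β := (F.scheme ℰp γ).β K }).β * wilsonAction4 (bg V)) + (∑ X, act X (bg V)) + cst + ({ prm j with β := (F.scheme ℰp γ).β K }).slack) + lf V) ∧
            (∀ V, 0 ≤ lf V) ∧ (∀ V, lf V ≤ Real.exp (-({ prm j with β := (F.scheme ℰp γ).β K }).cLF) * Real.exp (({ prm j with β := (F.scheme ℰp γ).β K }).c5 * Fintype.card (Site (F.P K) (K - j)))) ∧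
            (∀ V (S : Finset (Plaq (F.P K) (K - j))), (∀ p ∈ S, ({ prm j with β := (F.scheme ℰp γ).β K }).δL ≤ dist1 (GaugeField.plaqHol V p)) →
              readAtLevel F hjK (fun U => Real.exp κ * ρc U) V ≤ Real.exp (-(({ prm j with β := (F.scheme ℰp γ).β K }).cLF * S.card)) * Real.exp (({ prm j with β := (F.scheme ℰp γ).β K }).c5 * Fintype.card (Site (F.P K) (K - j)))) := by
  obtain ⟨prm, hadm, hfields, hmain⟩ := exists_admissible_schedule_phiM_tower_bg (F := F) W h hγ hγ1 hγe hb hp hr hM1 hMdvd hCD hR₀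
    (fun j => c / (1 - q) * q ^ j) hq0 hq1 (fun j => mul_nonneg (div_nonneg hc (by linarith)) (pow_nonneg hq0 j)) (fun j => le_rfl)
  refine ⟨prm, hadm, hfields, ?_⟩
  intro ν hν1 hν2 K Ts hTs μ χ hχ1 hχinv hχm hμ1 hμ2 j hjK ρc ρt hcc htc hc0 ht0 hμc hνt hlowc hupc hRegClass hlfle hlarge Dm Tg Sp Lg hTm hSpm hLgm hDo hplat hsupp
    hcover hgood hatom
  haveI : BorelSpace (GaugeField (F.P j) 0 ↥(Matrix.specialUnitaryGroup (Fin 2) ℂ)) := T3OrbitAverage.instBorelSpaceGaugeField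
  exact hmain ν hν1 hν2 K Ts hTs μ χ hχ1 hχinv hμ1 hμ2 j hjK ρc ρt hcc htc hc0 ht0 hμc hνt hlowc hupc hRegClass hlfle hlarge
    (hdomBG_of_atomicLetters F hγ.le ν μ χ Dm Tg Sp Lg hν1 hν2 hTs hχm hχ1 hμ1 hμ2 hjK hTm hSpm hLgm hplat hsupp hcover hDo.measurableSet ε hε hatom hDo
      (sum_Ico_le_geom hq0 hq1 hc hεc j Ts) ρc ρt hcc htc hc0 hμc hνt hgood)

end Summit.QuantumFields.YangMills.Theorems.FluctuationComparisonRegPrIntLS1aAlphaPhiMTowerAtomic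

end
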